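import Summits.BirchSwinnertonDyer.BirchSwinnertonDyer.Theses.UniversalToricDescent
import HarnessLib

/-!
# Route `UniversalToricDescent`: the GLUE `TwinSplitIMCAtThreeOfBuckets` of the split of crux #3
# `TwinSplitIMCAtThree` (item stmt-BirchSwinnertonDyer-20697, glue item of 20214, route rev 17) — CLOSED

Seat `bsd-wall-utd-p2` g2 (D-0131 (3) MIDDLE tier). The five children reassemble the parent: parity of
`d_K` (`Int.even_or_odd`; even ⟹ the parked child `TwinSplitIMCAtThreeEvenDisc`), then, for `d_K` odd, the
trichotomy of the reduction type of the twin `W′` at `3` under `¬ Addv W′ 3` (`Addv = ¬Good ∧ ¬Mult`;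
`Good` splits as `GoodOrd` = `3 ∤ a₃` / `GoodSS` = `3 ∣ a₃`): good-ordinary ⟹ `TwinSplitIMCAtThreeGoodOrdOfPrint`
fed with the three facts of `TwinSplitIMCAtThreePrintedFacts`; good-supersingular ⟹ `TwinSplitIMCAtThreeGoodSS`;
multiplicative ⟹ `TwinSplitIMCAtThreeMult`. Pure case analysis (the steward's sketch
HOME/bsd-wall/bsd-wall-pss3/rev17/SketchSplit20214.lean, `twinSplitIMCAtThree_of_buckets`, re-proved here against
the route declarations). Beyond-print: NO (bookkeeping). `--workitem stmt-BirchSwinnertonDyer-20697`.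

References: route file `Theses/UniversalToricDescent.lean` rev 17 (items 20692–20697); census TWIN-PRINT-AT3-v1 §2
(buckets A 745 / B 675 / C 603).
-/

noncomputable section

open scoped Classical

set_option linter.dupNamespace false
set_option autoImplicit false

namespace Summit.BirchSwinnertonDyer.BirchSwinnertonDyer.Theorems

open Summit.BirchSwinnertonDyer.BirchSwinnertonDyer.Theses.UniversalToricDescent

/-- **Glue `TwinSplitIMCAtThreeOfBuckets` (item 20697) holds**: `PrintedFacts → GoodOrdOfPrint → Mult → GoodSS →
EvenDisc → TwinSplitIMCAtThree`, by parity of `d_K` and the trichotomy good-ordinary / good-supersingular /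
multiplicative of the twin at `3` under `¬ Addv`. [folklore] -/
theorem twinSplitIMCAtThreeOfBuckets_proof :
    Summit.BirchSwinnertonDyer.BirchSwinnertonDyer.Theses.UniversalToricDescent.TwinSplitIMCAtThreeOfBuckets := by
  intro hF hA hB hC hD W' _ _ N' _ K _ _ Dt' hadd hsurj hN hK hH κ hκ γ _ 𝔭 h𝔭 he hf 𝔭' h𝔭' hne ι' hι
  rcases Int.even_or_odd (NumberField.discr K) with hev | hodd
  · exact hD W' N' K Dt' hadd hsurj hN hK hH hev κ hκ γ 𝔭 h𝔭 he hf 𝔭' h𝔭' hne ι' hι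
  by_cases hgood : W'.HasGoodReductionAtPrime 3
  · by_cases hss : (3 : ℤ) ∣ W'.frobeniusTrace 3
    · exact hC W' N' K Dt' ⟨hgood, by exact_mod_cast hss⟩ hsurj hN hK hH hodd κ hκ γ 𝔭 h𝔭 he hf 𝔭' h𝔭'
        hne ι' hι
    · exact hA hF.1 hF.2.1 hF.2.2 W' N' K Dt' ⟨hgood, by exact_mod_cast hss⟩ hsurj hN hK hH hodd κ hκ γ 𝔭
        h𝔭 he hf 𝔭' h𝔭' hne ι' hι
  · have hmult : W'.HasMultiplicativeReductionAtPrime 3 := by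
      by_contra h
      exact hadd ⟨hgood, h⟩
    exact hB W' N' K Dt' hmult hsurj hN hK hH hodd κ hκ γ 𝔭 h𝔭 he hf 𝔭' h𝔭' hne ι' hι

end Summit.BirchSwinnertonDyer.BirchSwinnertonDyer.Theorems

end
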